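/-
Copyright (c) 2026. All rights reserved.
Released under Apache 2.0 license as described in the file LICENSE.
-/
import Literature.Computability.Cryptography.RegevSamplerStageDesc
import Literature.Computability.QuantumComplexity.QFTBlockWordFP
import Literature.Computability.QuantumComplexity.QFTKitSizesFP
import Literature.Computability.QuantumComplexity.GenKitSizesFP
import Literature.Computability.Complexity.TVCorrector

/-!
# The sampler's Fourier STAGE word on codes

`RegevSamplerStageDesc.map_toAG_qftStage_std` abstracts the machine's Fourier stage to
`(finRange n).flatMap fun i => blockWord.map (AGmap (embA oS ℓR base (QFTKit.qbsize ℓR kF) i))`, and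
`QFTBlockWordFP.blockAN_codeFP_of` puts the block word on codes from `ℓR, kF` in unary.  Here the QFT kit's sizes
`regionSize`, `rb`, `qbsize` are put on codes in unary and the two are composed: the stage word on codes from a context
giving `n, ℓR, kF` in unary and `oS, base` in binary (`qftStageAN_codeFP_of`; `finRange` form via
`SimTokens.finRange_flatMap_val`). [cite: Regev2009, Lemma 3.14 (proof)] [cite: AroraBarak2009, §6.2 (proof of Thm. 6.15)]

HONEST FRAMING: the VALUE is a THEOREM (kernel-checked lemmas of a KNOWN reduction, Regev 2009) — NOT summit progress.
-/

noncomputable section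

namespace Literature.Computability.QuantumComplexity.QFTKit

open _root_.Computability Literature.Computability.Complexity Literature.Computability.Complexity.CodeFP AJLCore

/-- The QFT kit's region size `regionSize k κ` in unary on codes (input `(k, κ)`). [cite: AroraBarak2009, §6.2 (proof of Thm. 6.15)] -/
theorem regionSize_unary : CodeFP (pairE unE unE) unE (fun p => regionSize p.1 p.2) :=
  (unAdd.comp ((unAdd.comp ((TVCorr.unMulC.comp (qR_codeFP.pair (GenKit.thrWd_codeFP.comp (fst _ _)))).pair qF_codeFP)).pair
    (TVCorr.unMulC.comp (qT_codeFP.pair (GenKit.scrSize_codeFP.comp (GenKit.thrWd_codeFP.comp (fst _ _))))))).congr fun _ => rfl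

/-- The QFT kit's offset `rb κ k` in unary on codes (input `(κ, k)`). [cite: AroraBarak2009, §6.2 (proof of Thm. 6.15)] -/
theorem rb_unary : CodeFP (pairE unE unE) unE (fun p => rb p.1 p.2) := by
  have A : CodeFP (pairE unE unE) unE (fun p => p.1 + 2 + p.2) :=
    unAdd.comp ((unAdd.comp ((fst _ _).pair (const _ 2))).pair (snd _ _))
  have B : CodeFP (pairE unE unE) unE (fun p => p.2 + regionSize p.2 p.1) :=
    unAdd.comp ((snd _ _).pair (regionSize_unary.comp ((snd _ _).pair (fst _ _))))
  exact (unAdd.comp (A.pair B)).congr fun _ => rfl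

/-- **The QFT kit's block size `qbsize κ k` in unary on codes** (input `(κ, k)`). [cite: AroraBarak2009, §6.2 (proof of Thm. 6.15)] -/
theorem qbsize_unary : CodeFP (pairE unE unE) unE (fun p => qbsize p.1 p.2) :=
  (unAdd.comp (rb_unary.pair (regionSize_unary.comp ((snd _ _).pair (fst _ _))))).congr fun _ => rfl

end Literature.Computability.QuantumComplexity.QFTKit

namespace Literature.Computability.Cryptography.Regev2009.SamplerRegs

open _root_.Computability Literature.Computability.QuantumComplexity Literature.Computability.QuantumComplexity.AJLCore
  Literature.Computability.Complexity Literature.Computability.Complexity.CodeFP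

variable {σ : Type} {eσ : σ → List Bool}

/-- **The sampler's Fourier stage word on codes**: `n` copies of the QFT block word, copy `i` renamed by
`embA oS ℓR base (qbsize ℓR kF) i`, from `n, ℓR, kF` in unary and `oS, base` in binary. [cite: Regev2009, Lemma 3.14 (proof)]
[cite: AroraBarak2009, §6.2 (proof of Thm. 6.15)] -/
theorem qftStageAN_codeFP_of {n ℓR kF oS base : σ → ℕ} (hn : CodeFP eσ unE n) (hℓ : CodeFP eσ unE ℓR)
    (hk : CodeFP eσ unE kF) (hoS : CodeFP eσ natE oS) (hbase : CodeFP eσ natE base) :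
    CodeFP eσ (rawE agE0) (fun c => (List.range (n c)).flatMap fun i =>
      (QFTWord.blockAN (ℓR c) (kF c)).map (AGmap (embA (oS c) (ℓR c) (base c) (QFTKit.qbsize (ℓR c) (kF c)) i))) := by
  have hblock := QFTWord.blockAN_codeFP_of hℓ hk
  have hq : CodeFP eσ unE (fun c => QFTKit.qbsize (ℓR c) (kF c)) := QFTKit.qbsize_unary.comp (hℓ.pair hk)
  have hf := embA_codeFP_of hoS (BP.toNat hℓ) hbase (BP.toNat hq)
  have hF : CodeFP (pairE eσ natE) (rawE agE0) (fun q =>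
      (QFTWord.blockAN (ℓR q.1) (kF q.1)).map (AGmap (embA (oS q.1) (ℓR q.1) (base q.1) (QFTKit.qbsize (ℓR q.1) (kF q.1)) q.2))) :=
    ((mapAGmap_codeFP (σ := σ × ℕ) (f := fun q w => embA (oS q.1) (ℓR q.1) (base q.1) (QFTKit.qbsize (ℓR q.1) (kF q.1)) q.2 w) hf).comp
      ((CodeFP.id _).pair (hblock.comp (fst _ _))) :)
  exact UExec.flatMapRange hn hF

end Literature.Computability.Cryptography.Regev2009.SamplerRegs

end
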